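import Summits.AtomisticToContinuum.HydrodynamicLimit.Theses.AntiMazurCoboundaries
import Literature.Analysis.FluidPDE.HardSphereAlexander

/-!
# `BoltzmannGreenKubo`: the hypotheses `0 < a`, `0 < θ` are needed only for normalisability (degenerate cases)

Negative knowledge for the crux `AntiMazurCoboundaries.BoltzmannGreenKubo` (stmt-AtomisticToContinuum-13985), from the
standing disprover's `Cruxes/BoltzmannGreenKubo/Disproof.lean` §1b: the crux VERBATIM with `0 < a` weakened to `0 ≤ a`
(`BoltzmannGreenKuboNonnegActivity`), resp. `0 < θ` weakened to `0 ≤ θ` (`BoltzmannGreenKuboNonnegTemperature`), is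
FALSE — but for the junk reason only: at `a = 0` (resp. `θ = 0`, where the local Maxwellian is the junk value
`(2π·0)^{-3/2}·… = 0`) the constant-profile local Gibbs laws are the ZERO measure, so the statement's own first conjunct
(the laws are probability measures) fails; a flow to instantiate it exists by Alexander's theorem. Informative content
for provers: nothing dynamical hides in these two hypotheses (at fixed particle number the activity cancels from
`canonicalDensity`; `θ` is a velocity rescaling).
refuter-cdisprove-stmt-AtomisticToContinuum-13985-0.
-/

noncomputable section

namespace Summit.AtomisticToContinuum.HydrodynamicLimit.Theorems

open MeasureTheory ProbabilityTheory
open Literature.Analysis.FluidPDE Literature.MathematicalPhysics.KineticTheory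
open Literature.Analysis.UnboundedOperators

namespace BoltzmannGreenKuboDegenerate

/-- If the one-particle profile vanishes identically, the local Gibbs law is the ZERO measure (so it is not a
probability measure). [folklore] -/
theorem localGibbsLaw_eq_zero_of_profile_eq_zero {σ : ℝ} {a₀ θ₀ : T3 → ℝ} {u₀ : T3 → V3}
    (h : ∀ y, localGibbsProfile a₀ u₀ θ₀ y = 0) (N : ℕ)
    (Φ : HardSphereFlow (Torus.geometry (Fin 3)) (hsDiameter σ N) (N + 1)) :
    localGibbsLaw σ a₀ u₀ θ₀ N Φ = 0 := by
  have hprof : localGibbsProfile a₀ u₀ θ₀ = 0 := funext h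
  rw [localGibbsLaw, particleLaw_eq, hprof]
  have hdens : (fun z : Config (N + 1) (Fin 3) T3 => ENNReal.ofReal
      (canonicalDensity (Torus.geometry (Fin 3)) (hsDiameter σ N) (N + 1) 0 z)) = 0 := by
    funext z
    simp [canonicalDensity, tensorPow, Set.indicator]
  rw [hdens]
  exact withDensity_zero

/-- A zero measure is not a probability measure. [folklore] -/
theorem not_isProbabilityMeasure_zero {Ω : Type*} [MeasurableSpace Ω] :
    ¬ IsProbabilityMeasure (0 : Measure Ω) := by
  intro h
  have h1 : (0 : Measure Ω) Set.univ = 1 := h.measure_univ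
  simp only [Measure.coe_zero, Pi.zero_apply] at h1
  exact zero_ne_one h1

/-- The zero observable satisfies the orthogonality clause. [folklore] -/
theorem zero_orth : ∀ (c₀ c₂ : ℝ) (b : V3),
    ∫ v, (fun _ : V3 => (0 : ℝ)) v * (c₀ + inner ℝ b v + c₂ * ‖v‖ ^ 2) ∂(stdGaussian V3) = 0 := by
  intro c₀ c₂ b
  simp

/-- Shared skeleton: if the constant-profile local Gibbs laws at `(a, u₀, θ)` all VANISH, no statement of the
crux's shape with that `(a, θ, u₀)` admitted can hold (its first conjunct asks for probability measures; a flow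
to instantiate it exists by Alexander's theorem). [folklore] -/
theorem probability_clause_fails {a θ : ℝ} {u₀ : V3}
    (hzero : ∀ (σ : ℝ) (N : ℕ) (Φ : HardSphereFlow (Torus.geometry (Fin 3)) (hsDiameter σ N) (N + 1)),
      localGibbsLaw σ (fun _ => a) (fun _ => u₀) (fun _ => θ) N Φ = 0)
    {σ₀ : ℝ} (hσ₀ : 0 < σ₀)
    (h : ∀ σ : ℝ, 0 < σ → σ < σ₀ → ∀ (N : ℕ)
      (Φ : HardSphereFlow (Torus.geometry (Fin 3)) (hsDiameter σ N) (N + 1)),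
      IsProbabilityMeasure (localGibbsLaw σ (fun _ => a) (fun _ => u₀) (fun _ => θ) N Φ)) : False := by
  set σ : ℝ := min (σ₀ / 2) (1 / 4) with hσdef
  have hσpos : 0 < σ := lt_min (by linarith) (by norm_num)
  have hσlt : σ < σ₀ := lt_of_le_of_lt (min_le_left _ _) (by linarith)
  have hεpos : 0 < hsDiameter σ 0 := hsDiameter_pos hσpos 0
  have hεlt : hsDiameter σ 0 < 2⁻¹ := by
    have := hsDiameter_le hσpos.le 0
    have hσle : σ ≤ 1 / 4 := min_le_right _ _
    linarith
  obtain ⟨Φ⟩ := HardSphereFlow.nonempty_torus_holds (d := Fin 3) hεpos hεlt (0 + 1)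
  have hp := h σ hσpos hσlt 0 Φ
  rw [hzero σ 0 Φ] at hp
  exact not_isProbabilityMeasure_zero hp

end BoltzmannGreenKuboDegenerate

/-- `BoltzmannGreenKubo` with `0 < a` WEAKENED to `0 ≤ a` (all else verbatim). -/
def BoltzmannGreenKuboNonnegActivity : Prop :=
  ∀ (a θ : ℝ) (u₀ : Literature.MathematicalPhysics.KineticTheory.V3), 0 ≤ a → 0 < θ → ∀ (φ : Literature.MathematicalPhysics.KineticTheory.T3 → ℝ) (g : Literature.MathematicalPhysics.KineticTheory.V3 → ℝ), Continuous φ → Continuous g → (∀ x, |φ x| ≤ 1) → (∃ K : ℝ, ∀ v, |g v| ≤ K) → (∀ (c₀ c₂ : ℝ) (b : Literature.MathematicalPhysics.KineticTheory.V3), ∫ v, g v * (c₀ + inner ℝ b v + c₂ * ‖v‖ ^ 2) ∂(ProbabilityTheory.stdGaussian Literature.MathematicalPhysics.KineticTheory.V3) = 0) → ∀ η : ℝ, 0 < η → ∃ s₀ : ℝ, 0 < s₀ ∧ ∀ s : ℝ, s₀ ≤ s → ∃ σ₀ : ℝ, 0 < σ₀ ∧ ∀ σ : ℝ, 0 < σ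 → σ < σ₀ → (∀ (N : ℕ) (Φ : Literature.Analysis.FluidPDE.HardSphereFlow (Literature.Analysis.FluidPDE.Torus.geometry (Fin 3)) (Literature.MathematicalPhysics.KineticTheory.hsDiameter σ N) (N + 1)), MeasureTheory.IsProbabilityMeasure (Literature.MathematicalPhysics.KineticTheory.localGibbsLaw σ (fun _ => a) (fun _ => u₀) (fun _ => θ) N Φ)) ∧ ∃ N₀ : ℕ, ∀ N : ℕ, N₀ ≤ N → ∀ Φ : Literature.Analysis.FluidPDE.HardSphereFlow (Literature.Analysis.FluidPDE.Torus.geometry (Fin 3)) (Literature.MathematicalPhysics.KineticTheory.hsDiameter σ N) (N + 1), (let h : ℝ := s / (σ ^ 2 * Real.sqrt θ) * ((N + 1 : ℕ) : ℝ) ^ (-(1 / 3 : ℝ)); |s * ((∫⁻ z, ENNReal.ofReal ((h⁻¹ * ∫ r in (0 : ℝ)..h, ∑ i, φ (Φ.flow r z i).1 * g ((Real.sqrt θ)⁻¹ • ((Φ.flow r z i).2 - u₀))) ^ 2) ∂(Literature.MathematicalPhysics.KineticTheory.localGibbsLaw σ (fun _ => a) (fun _ => u₀) (fun _ => θ) N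 Φ)).toReal / (((N : ℝ)) + 1)) - 2 * (∫ x, φ x ^ 2) * Literature.Analysis.UnboundedOperators.dirichletFormInv (Literature.Analysis.UnboundedOperators.hardSphereLinearizedOp (E := Literature.MathematicalPhysics.KineticTheory.V3)) g| ≤ η)

/-- `BoltzmannGreenKubo` with `0 < θ` WEAKENED to `0 ≤ θ` (all else verbatim). -/
def BoltzmannGreenKuboNonnegTemperature : Prop :=
  ∀ (a θ : ℝ) (u₀ : Literature.MathematicalPhysics.KineticTheory.V3), 0 < a → 0 ≤ θ → ∀ (φ : Literature.MathematicalPhysics.KineticTheory.T3 → ℝ) (g : Literature.MathematicalPhysics.KineticTheory.V3 → ℝ), Continuous φ → Continuous g → (∀ x, |φ x| ≤ 1) → (∃ K : ℝ, ∀ v, |g v| ≤ K) → (∀ (c₀ c₂ : ℝ) (b : Literature.MathematicalPhysics.KineticTheory.V3), ∫ v, g v * (c₀ + inner ℝ b v + c₂ * ‖v‖ ^ 2) ∂(ProbabilityTheory.stdGaussian Literature.MathematicalPhysics.KineticTheory.V3) = 0) → ∀ η : ℝ, 0 < η → ∃ s₀ : ℝ, 0 < s₀ ∧ ∀ s : ℝ,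 s₀ ≤ s → ∃ σ₀ : ℝ, 0 < σ₀ ∧ ∀ σ : ℝ, 0 < σ → σ < σ₀ → (∀ (N : ℕ) (Φ : Literature.Analysis.FluidPDE.HardSphereFlow (Literature.Analysis.FluidPDE.Torus.geometry (Fin 3)) (Literature.MathematicalPhysics.KineticTheory.hsDiameter σ N) (N + 1)), MeasureTheory.IsProbabilityMeasure (Literature.MathematicalPhysics.KineticTheory.localGibbsLaw σ (fun _ => a) (fun _ => u₀) (fun _ => θ) N Φ)) ∧ ∃ N₀ : ℕ, ∀ N : ℕ, N₀ ≤ N → ∀ Φ : Literature.Analysis.FluidPDE.HardSphereFlow (Literature.Analysis.FluidPDE.Torus.geometry (Fin 3)) (Literature.MathematicalPhysics.KineticTheory.hsDiameter σ N) (N + 1), (let h : ℝ := s / (σ ^ 2 * Real.sqrt θ) * ((N + 1 : ℕ) : ℝ) ^ (-(1 / 3 : ℝ)); |s * ((∫⁻ z, ENNReal.ofReal ((h⁻¹ * ∫ r in (0 : ℝ)..h, ∑ i, φ (Φ.flow r z i).1 * g ((Real.sqrt θ)⁻¹ • ((Φ.flow r z i).2 - u₀))) ^ 2) ∂(Literature.MathematicalPhysics.KineticTheory.localGibbsLaw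 σ (fun _ => a) (fun _ => u₀) (fun _ => θ) N Φ)).toReal / (((N : ℝ)) + 1)) - 2 * (∫ x, φ x ^ 2) * Literature.Analysis.UnboundedOperators.dirichletFormInv (Literature.Analysis.UnboundedOperators.hardSphereLinearizedOp (E := Literature.MathematicalPhysics.KineticTheory.V3)) g| ≤ η)

open BoltzmannGreenKuboDegenerate in
/-- `0 < a` IS NEEDED, BUT ONLY FOR NORMALISABILITY: at `a = 0` the local Gibbs laws are the zero measure, so
the probability clause fails (degenerate bookkeeping, not a dynamical obstruction; at fixed particle number the
activity otherwise cancels from `canonicalDensity`). [folklore] -/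
theorem boltzmannGreenKubo_false_nonnegActivity : ¬ BoltzmannGreenKuboNonnegActivity := by
  intro h
  obtain ⟨s₀, hs₀, h2⟩ := h 0 1 0 le_rfl one_pos (fun _ => 0) (fun _ => 0) continuous_const
    continuous_const (fun _ => by simp) ⟨0, fun _ => by simp⟩ zero_orth 1 one_pos
  obtain ⟨σ₀, hσ₀, h3⟩ := h2 s₀ le_rfl
  refine probability_clause_fails (a := 0) (θ := 1) (u₀ := 0) (fun σ N Φ => ?_) hσ₀
    (fun σ hσ hσ' => (h3 σ hσ hσ').1)
  refine localGibbsLaw_eq_zero_of_profile_eq_zero (fun y => ?_) N Φ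
  simp [localGibbsProfile]

open BoltzmannGreenKuboDegenerate in
/-- `0 < θ` IS NEEDED, BUT ONLY FOR NORMALISABILITY: at `θ = 0` the local Maxwellian is the junk value `0`
(`(2π·0)^{-3/2} = 0`), the laws vanish and the probability clause fails. [folklore] -/
theorem boltzmannGreenKubo_false_nonnegTemperature : ¬ BoltzmannGreenKuboNonnegTemperature := by
  intro h
  obtain ⟨s₀, hs₀, h2⟩ := h 1 0 0 one_pos le_rfl (fun _ => 0) (fun _ => 0) continuous_const
    continuous_const (fun _ => by simp) ⟨0, fun _ => by simp⟩ zero_orth 1 one_pos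
  obtain ⟨σ₀, hσ₀, h3⟩ := h2 s₀ le_rfl
  refine probability_clause_fails (a := 1) (θ := 0) (u₀ := 0) (fun σ N Φ => ?_) hσ₀
    (fun σ hσ hσ' => (h3 σ hσ hσ').1)
  refine localGibbsLaw_eq_zero_of_profile_eq_zero (fun y => ?_) N Φ
  have hfin : (Module.finrank ℝ V3 : ℝ) = 3 := by simp
  simp only [localGibbsProfile, localMaxwellian, hfin, mul_zero, one_mul]
  rw [Real.zero_rpow (by norm_num)]
  simp


end Summit.AtomisticToContinuum.HydrodynamicLimit.Theorems

end
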